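import Mathlib

/-!
# Crux `NearExtremalTransiencePerFlow` (stmt-NavierStokesRegularity-26567), LINE g7-β `zone_transversality`:
# STUB Z4 `stub_zoneCalculus` — the zone calculus (pure real analysis)

Theorems file (lands `--supports stmt-NavierStokesRegularity-26567`) proving the registered stub `stub_zoneCalculus`
of the skeleton `Cruxes/NearExtremalTransiencePerFlow/Lines/zone_transversality.lean` EXACTLY as registered.

Statement.  `k : ℝ → ℝ` measurable, `0 ≤ k`, `k ≤ κs` and continuous on `[t₁,T)`; SOJOURN BOUND: every closed interval
`[s,t] ⊂ [t₁,T)` on which `k ≥ κs − ε` has log-length `log((T−s)/(T−t)) ≤ L`; ZONE-LIPSCHITZ: on such intervals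
`|k t − k s| ≤ Λ·log((T−s)/(T−t))`.  Conclusion: `∫_{t₁}^{t} k²/(T−τ) dτ ≤ (θ₀κs)²·log((T−t₁)/(T−t)) + B` on `[t₁,T)` for some
`θ₀ ∈ [0,1)` and `B`.

Proof.  (1) Log-time `σ = log((T−t₁)/(T−τ))`, `τ = φ σ = T − (T−t₁)e^{−σ}`: the monotone change of variables
(`intervalIntegral.integral_comp_mul_deriv_of_deriv_nonneg`, no continuity needed) turns the weighted integral into
`∫_0^S g²` with `g = k ∘ φ` on `[0,∞)`, and the two hypotheses into statements about lengths `b − a`.  We may shrink `ε` to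
`ε' = min ε κs`.  (2) CLIMB LEMMA (`le_of_short_climb`): if `g a ≤ κ − ε'` and `Λ(b − a) < ε' − δ` then `g b ≤ κ − δ` — take the
last time `c = sSup {σ ∈ [a,b] : g σ ≤ κ − ε'}` (closed set), `g c = κ − ε'` by the intermediate value theorem, the zone-Lipschitz
bound on `[c,b]` gives `g b − g c ≤ Λ(b − c) < ε' − δ`.  (3) WINDOW LEMMA: every window `[a, a+W]`, `W = L + 1 + h`, `h = ε'/(4Λ)`,
contains (sojourn bound on `[a, a+L+1]`) a time `σ₀` with `g σ₀ < κ − ε'`, hence (climb lemma with `δ = ε'/2`) `g ≤ κ − ε'/2` on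
`[σ₀, σ₀+h]`, so `∫_a^{a+W} g² ≤ κ²W − (κε'/2)h`.  (4) Floor-induction over windows: `∫_0^S g² ≤ (κ² − c/W)S + κ²W`.
HONEST FRAMING: a lemma about one real function; nothing about Navier–Stokes is proved here; no summit is proved by a line.
[folklore]
-/

noncomputable section

open Set MeasureTheory intervalIntegral

namespace Summit.NavierStokesRegularity.NavierStokesRegularity.Theorems.NearExtremalTransiencePerFlow.ZoneTransversality
-- the summit's namespace `Summit.NavierStokesRegularity.NavierStokesRegularity` repeats the problem name by convention (D-0017)
set_option linter.dupNamespace false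

/-! ### (2) The climb lemma -/

/-- CLIMB LEMMA.  `g` continuous on `[a,b]`, `g a ≤ κ − ε`, zone-Lipschitz with constant `Λ` on sub-intervals of `[a,b]`
lying in the zone `{g ≥ κ − ε}`, and `Λ(b − a) < ε − δ`: then `g b ≤ κ − δ` (the climb from `κ − ε` to `κ − δ` takes
length at least `(ε − δ)/Λ`). [folklore] -/
theorem le_of_short_climb {g : ℝ → ℝ} {κ ε δ Λ a b : ℝ} (hΛ : 0 < Λ) (hab : a ≤ b)
    (hcont : ContinuousOn g (Icc a b)) (hga : g a ≤ κ - ε)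
    (hlip : ∀ x y : ℝ, a ≤ x → x ≤ y → y ≤ b → (∀ σ ∈ Icc x y, κ - ε ≤ g σ) →
      |g y - g x| ≤ Λ * (y - x))
    (hlen : Λ * (b - a) < ε - δ) : g b ≤ κ - δ := by
  by_contra hgb
  push Not at hgb
  obtain ⟨S, hS⟩ : ∃ S : Set ℝ, S = Icc a b ∩ g ⁻¹' Iic (κ - ε) := ⟨_, rfl⟩
  have hSclosed : IsClosed S := by
    rw [hS]; exact hcont.preimage_isClosed_of_isClosed isClosed_Icc isClosed_Iic
  have haS : a ∈ S := by rw [hS]; exact ⟨left_mem_Icc.2 hab, hga⟩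
  have hSne : S.Nonempty := ⟨a, haS⟩
  have hSbdd : BddAbove S := ⟨b, fun σ hσ => by rw [hS] at hσ; exact hσ.1.2⟩
  obtain ⟨c, hc⟩ : ∃ c : ℝ, c = sSup S := ⟨_, rfl⟩
  have hcS : c ∈ S := by rw [hc]; exact hSclosed.csSup_mem hSne hSbdd
  rw [hS] at hcS
  have hac : a ≤ c := hcS.1.1
  have hcb : c ≤ b := hcS.1.2
  have hgc : g c ≤ κ - ε := hcS.2
  -- strictly after `c` the function is strictly above `κ − ε`
  have habove : ∀ σ ∈ Icc c b, c < σ → κ - ε < g σ := by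
    intro σ hσ hcσ
    by_contra h
    push Not at h
    have hσS : σ ∈ S := by rw [hS]; exact ⟨⟨hac.trans hσ.1, hσ.2⟩, h⟩
    have : σ ≤ c := by rw [hc]; exact le_csSup hSbdd hσS
    linarith
  -- `g c = κ − ε` (intermediate value theorem on `[c,b]`)
  have hgc' : κ - ε ≤ g c := by
    have hcont' : ContinuousOn g (Icc c b) := hcont.mono (Icc_subset_Icc_left hac)
    have hΛba : 0 ≤ Λ * (b - a) := mul_nonneg hΛ.le (sub_nonneg.2 hab)
    have hmem : κ - ε ∈ Icc (g c) (g b) := ⟨hgc, by linarith⟩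
    obtain ⟨ξ, hξ, hgξ⟩ := intermediate_value_Icc hcb hcont' hmem
    rcases eq_or_lt_of_le hξ.1 with h | h
    · rw [h, hgξ]
    · have := habove ξ hξ h
      linarith
  have hzone : ∀ σ ∈ Icc c b, κ - ε ≤ g σ := by
    intro σ hσ
    rcases eq_or_lt_of_le hσ.1 with h | h
    · rw [← h]; exact hgc'
    · exact (habove σ hσ h).le
  have hL := hlip c b hac hcb le_rfl hzone
  have h1 : g b - g c ≤ Λ * (b - c) := (le_abs_self _).trans hL
  have h2 : Λ * (b - c) ≤ Λ * (b - a) := mul_le_mul_of_nonneg_left (by linarith) hΛ.le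
  linarith

/-! ### (3) The window lemma -/

/-- `∫_x^y g² ≤ C²(y − x)` when `0 ≤ g ≤ C` on `[x,y]`. [folklore] -/
theorem integral_sq_le_of_bounds {g : ℝ → ℝ} {x y C : ℝ} (hxy : x ≤ y)
    (hg0 : ∀ σ ∈ Icc x y, 0 ≤ g σ) (hgC : ∀ σ ∈ Icc x y, g σ ≤ C) :
    ∫ σ in x..y, g σ ^ 2 ≤ C ^ 2 * (y - x) := by
  have h := intervalIntegral.norm_integral_le_of_norm_le_const (a := x) (b := y) (C := C ^ 2)
    (f := fun σ => g σ ^ 2) ?_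
  · rw [abs_of_nonneg (sub_nonneg.2 hxy)] at h
    exact (Real.le_norm_self _).trans h
  · intro σ hσ
    rw [Set.uIoc_of_le hxy] at hσ
    have hσ' : σ ∈ Icc x y := ⟨hσ.1.le, hσ.2⟩
    rw [Real.norm_eq_abs, abs_of_nonneg (sq_nonneg _)]
    exact pow_le_pow_left₀ (hg0 σ hσ') (hgC σ hσ') 2

/-- Interval integrability of `g²` on `[x,y] ⊂ [0,∞)` for `g` continuous on `[0,∞)`. [folklore] -/
theorem intervalIntegrable_sq_of_continuousOn {g : ℝ → ℝ} (hcont : ContinuousOn g (Ici 0)) {x y : ℝ}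
    (hx : 0 ≤ x) (hxy : x ≤ y) : IntervalIntegrable (fun σ => g σ ^ 2) volume x y := by
  refine ((hcont.pow 2).mono ?_).intervalIntegrable
  intro σ hσ
  rw [uIcc_of_le hxy] at hσ
  exact hx.trans hσ.1

/-- WINDOW LEMMA.  On `[0,∞)`: `g` continuous, `0 ≤ g ≤ κ`, `0 < ε ≤ κ`, sojourn bound `L` and zone-Lipschitz constant
`Λ` for the zone `{g ≥ κ − ε}` (both in terms of lengths).  Then every window `[a, a + W]`, `W = L + 1 + ε/(4Λ)`, has
`∫_a^{a+W} g² ≤ κ²W − (κε/2)(ε/(4Λ))`. [folklore] -/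
theorem window_integral_le {g : ℝ → ℝ} {κ ε L Λ : ℝ} (hε : 0 < ε) (hεκ : ε ≤ κ) (hL : 0 ≤ L)
    (hΛ : 0 < Λ) (hcont : ContinuousOn g (Ici 0)) (hg0 : ∀ σ : ℝ, 0 ≤ σ → 0 ≤ g σ)
    (hgκ : ∀ σ : ℝ, 0 ≤ σ → g σ ≤ κ)
    (hsoj : ∀ a b : ℝ, 0 ≤ a → a ≤ b → (∀ σ ∈ Icc a b, κ - ε ≤ g σ) → b - a ≤ L)
    (hlip : ∀ a b : ℝ, 0 ≤ a → a ≤ b → (∀ σ ∈ Icc a b, κ - ε ≤ g σ) → |g b - g a| ≤ Λ * (b - a))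
    {a : ℝ} (ha : 0 ≤ a) :
    ∫ σ in a..(a + (L + 1 + ε / (4 * Λ))), g σ ^ 2 ≤
      κ ^ 2 * (L + 1 + ε / (4 * Λ)) - (κ * ε / 2) * (ε / (4 * Λ)) := by
  obtain ⟨h, hh⟩ : ∃ h : ℝ, h = ε / (4 * Λ) := ⟨_, rfl⟩
  have hh0 : 0 < h := by rw [hh]; positivity
  have hΛh : Λ * h = ε / 4 := by rw [hh]; field_simp
  rw [← hh]
  -- Step 1: a time below `κ − ε` in `[a, a + L + 1]`
  obtain ⟨σ₀, hσ₀, hgσ₀⟩ : ∃ σ₀ ∈ Icc a (a + (L + 1)), g σ₀ < κ - ε := by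
    by_contra H
    push Not at H
    have := hsoj a (a + (L + 1)) ha (by linarith) H
    linarith
  have hσ₀0 : 0 ≤ σ₀ := ha.trans hσ₀.1
  -- Step 2: on `[σ₀, σ₀ + h]` the function stays below `κ − ε/2`
  have hgood : ∀ σ ∈ Icc σ₀ (σ₀ + h), g σ ≤ κ - ε / 2 := by
    intro σ hσ
    refine le_of_short_climb (ε := ε) (δ := ε / 2) hΛ hσ.1
      (hcont.mono fun x hx => hσ₀0.trans hx.1) hgσ₀.le ?_ ?_
    · intro x y hx hxy _ hz
      exact hlip x y (hσ₀0.trans hx) hxy hz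
    · have h1 : σ - σ₀ ≤ h := by linarith [hσ.2]
      calc Λ * (σ - σ₀) ≤ Λ * h := mul_le_mul_of_nonneg_left h1 hΛ.le
        _ = ε / 4 := hΛh
        _ < ε - ε / 2 := by linarith
  -- Step 3: split the window integral at `σ₀` and `σ₀ + h`
  have hend : σ₀ + h ≤ a + (L + 1 + h) := by linarith [hσ₀.2]
  have i1 : IntervalIntegrable (fun σ => g σ ^ 2) volume a σ₀ :=
    intervalIntegrable_sq_of_continuousOn hcont ha hσ₀.1
  have i2 : IntervalIntegrable (fun σ => g σ ^ 2) volume σ₀ (σ₀ + h) :=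
    intervalIntegrable_sq_of_continuousOn hcont hσ₀0 (by linarith)
  have i3 : IntervalIntegrable (fun σ => g σ ^ 2) volume (σ₀ + h) (a + (L + 1 + h)) :=
    intervalIntegrable_sq_of_continuousOn hcont (by linarith) hend
  have hsplit : ∫ σ in a..(a + (L + 1 + h)), g σ ^ 2 =
      (∫ σ in a..σ₀, g σ ^ 2) + (∫ σ in σ₀..(σ₀ + h), g σ ^ 2) +
        ∫ σ in (σ₀ + h)..(a + (L + 1 + h)), g σ ^ 2 := by
    rw [intervalIntegral.integral_add_adjacent_intervals i1 i2,
      intervalIntegral.integral_add_adjacent_intervals (i1.trans i2) i3]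
  have b1 : ∫ σ in a..σ₀, g σ ^ 2 ≤ κ ^ 2 * (σ₀ - a) :=
    integral_sq_le_of_bounds hσ₀.1 (fun σ hσ => hg0 σ (ha.trans hσ.1))
      (fun σ hσ => hgκ σ (ha.trans hσ.1))
  have b2 : ∫ σ in σ₀..(σ₀ + h), g σ ^ 2 ≤ (κ - ε / 2) ^ 2 * (σ₀ + h - σ₀) :=
    integral_sq_le_of_bounds (by linarith) (fun σ hσ => hg0 σ (hσ₀0.trans hσ.1)) hgood
  have b3 : ∫ σ in (σ₀ + h)..(a + (L + 1 + h)), g σ ^ 2 ≤ κ ^ 2 * (a + (L + 1 + h) - (σ₀ + h)) :=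
    integral_sq_le_of_bounds hend (fun σ hσ => hg0 σ (by linarith [hσ.1]))
      (fun σ hσ => hgκ σ (by linarith [hσ.1]))
  have hsq : (κ - ε / 2) ^ 2 * (σ₀ + h - σ₀) ≤ (κ ^ 2 - κ * ε / 2) * h := by
    rw [show σ₀ + h - σ₀ = h by ring]
    refine mul_le_mul_of_nonneg_right ?_ hh0.le
    nlinarith
  rw [hsplit]
  nlinarith [b1, b2, b3, hsq]

/-! ### (4) Summation over windows -/

/-- CORE LEMMA (log-time form of the stub).  On `[0,∞)`: `g` continuous, `0 ≤ g ≤ κ`, `0 < ε ≤ κ`, sojourn bound and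
zone-Lipschitz bound in terms of lengths.  Then `∫_0^S g² ≤ (θ₀κ)²S + B` for all `S ≥ 0`, for some `θ₀ ∈ [0,1)`, `B`.
[folklore] -/
theorem mean_sq_le_of_sojourn {g : ℝ → ℝ} {κ ε L Λ : ℝ} (hκ : 0 < κ) (hε : 0 < ε) (hεκ : ε ≤ κ)
    (hL : 0 ≤ L) (hΛ : 0 < Λ) (hcont : ContinuousOn g (Ici 0)) (hg0 : ∀ σ : ℝ, 0 ≤ σ → 0 ≤ g σ)
    (hgκ : ∀ σ : ℝ, 0 ≤ σ → g σ ≤ κ)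
    (hsoj : ∀ a b : ℝ, 0 ≤ a → a ≤ b → (∀ σ ∈ Icc a b, κ - ε ≤ g σ) → b - a ≤ L)
    (hlip : ∀ a b : ℝ, 0 ≤ a → a ≤ b → (∀ σ ∈ Icc a b, κ - ε ≤ g σ) → |g b - g a| ≤ Λ * (b - a)) :
    ∃ θ₀ B : ℝ, 0 ≤ θ₀ ∧ θ₀ < 1 ∧ ∀ S : ℝ, 0 ≤ S → ∫ σ in 0..S, g σ ^ 2 ≤ (θ₀ * κ) ^ 2 * S + B := by
  obtain ⟨W, hW⟩ : ∃ W : ℝ, W = L + 1 + ε / (4 * Λ) := ⟨_, rfl⟩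
  obtain ⟨c, hc⟩ : ∃ c : ℝ, c = (κ * ε / 2) * (ε / (4 * Λ)) := ⟨_, rfl⟩
  have hh0 : 0 < ε / (4 * Λ) := by positivity
  have hW0 : 0 < W := by rw [hW]; linarith
  have hc0 : 0 < c := by rw [hc]; positivity
  have hcW : c < κ ^ 2 * W := by
    rw [hc, hW]
    have h1 : κ * ε / 2 ≤ κ ^ 2 := by nlinarith
    have h2 : κ * ε / 2 * (ε / (4 * Λ)) ≤ κ ^ 2 * (ε / (4 * Λ)) := mul_le_mul_of_nonneg_right h1 hh0.le
    nlinarith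
  have hκW : 0 < κ ^ 2 * W := by positivity
  have hratio0 : 0 < c / (κ ^ 2 * W) := div_pos hc0 hκW
  have hratio1 : c / (κ ^ 2 * W) < 1 := (div_lt_one hκW).2 hcW
  -- the window estimate at every `a ≥ 0`
  have hwin : ∀ a : ℝ, 0 ≤ a → ∫ σ in a..(a + W), g σ ^ 2 ≤ κ ^ 2 * W - c := by
    intro a ha
    rw [hW, hc]
    exact window_integral_le hε hεκ hL hΛ hcont hg0 hgκ hsoj hlip ha
  refine ⟨Real.sqrt (1 - c / (κ ^ 2 * W)), κ ^ 2 * W, Real.sqrt_nonneg _, ?_, ?_⟩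
  · rw [Real.sqrt_lt' one_pos, one_pow]
    linarith
  intro S hS
  have hθ : (Real.sqrt (1 - c / (κ ^ 2 * W)) * κ) ^ 2 = κ ^ 2 - c / W := by
    rw [mul_pow, Real.sq_sqrt (by linarith)]
    field_simp
  rw [hθ]
  -- floor decomposition `S = S₀ + n W`, `S₀ ∈ [0, W)`
  obtain ⟨n, hn⟩ : ∃ n : ℕ, n = ⌊S / W⌋₊ := ⟨_, rfl⟩
  obtain ⟨S₀, hS₀⟩ : ∃ S₀ : ℝ, S₀ = S - n * W := ⟨_, rfl⟩
  have hnle : (n : ℝ) * W ≤ S := by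
    have := Nat.floor_le (div_nonneg hS hW0.le)
    rw [← hn] at this
    rwa [le_div_iff₀ hW0] at this
  have hnlt : S < (n + 1 : ℝ) * W := by
    have := Nat.lt_floor_add_one (S / W)
    rw [← hn] at this
    rwa [div_lt_iff₀ hW0] at this
  have hS₀0 : 0 ≤ S₀ := by rw [hS₀]; linarith
  have hS₀W : S₀ < W := by rw [hS₀]; linarith
  have hSeq : S = S₀ + n * W := by rw [hS₀]; ring
  -- induction over the windows
  have key : ∀ m : ℕ, ∫ σ in 0..(S₀ + m * W), g σ ^ 2 ≤ κ ^ 2 * S₀ + m * (κ ^ 2 * W - c) := by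
    intro m
    induction m with
    | zero =>
      simp only [Nat.cast_zero, zero_mul, add_zero]
      have := integral_sq_le_of_bounds (g := g) (C := κ) hS₀0 (fun σ hσ => hg0 σ hσ.1)
        (fun σ hσ => hgκ σ hσ.1)
      simpa using this
    | succ m ih =>
      have hm0 : 0 ≤ S₀ + m * W := by positivity
      have i1 : IntervalIntegrable (fun σ => g σ ^ 2) volume 0 (S₀ + m * W) :=
        intervalIntegrable_sq_of_continuousOn hcont le_rfl hm0
      have i2 : IntervalIntegrable (fun σ => g σ ^ 2) volume (S₀ + m * W) (S₀ + m * W + W) :=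
        intervalIntegrable_sq_of_continuousOn hcont hm0 (by linarith)
      have hsplit : ∫ σ in 0..(S₀ + (m + 1 : ℕ) * W), g σ ^ 2 =
          (∫ σ in 0..(S₀ + m * W), g σ ^ 2) + ∫ σ in (S₀ + m * W)..(S₀ + m * W + W), g σ ^ 2 := by
        rw [intervalIntegral.integral_add_adjacent_intervals i1 i2]
        congr 1
        push_cast
        ring
      rw [hsplit]
      have hw := hwin (S₀ + m * W) hm0
      push_cast
      linarith
  have hfin := key n
  rw [← hSeq] at hfin
  have hcS₀ : c / W * S₀ ≤ c := by
    have : S₀ / W ≤ 1 := (div_le_one hW0).2 hS₀W.le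
    calc c / W * S₀ = c * (S₀ / W) := by ring
      _ ≤ c * 1 := mul_le_mul_of_nonneg_left this hc0.le
      _ = c := mul_one c
  have hexp : (κ ^ 2 - c / W) * S + κ ^ 2 * W =
      κ ^ 2 * S₀ + n * (κ ^ 2 * W - c) + (κ ^ 2 * W - c / W * S₀) := by
    rw [hSeq]
    field_simp
    ring
  rw [hexp]
  linarith

/-! ### (1) The change of variables and the registered stub -/

/-- **Z4 `stub_zoneCalculus`** of LINE g7-β `zone_transversality` (crux stmt-NavierStokesRegularity-26567), EXACTLY as
registered: continuity + sojourn bound + zone-Lipschitz + `0 ≤ k ≤ κs` on `[t₁,T)` give a log-mean of `k²` at most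
`(θ₀κs)²` for some `θ₀ < 1`. [folklore] -/
theorem stub_zoneCalculus :
    ∀ (k : ℝ → ℝ) (T t₁ κs ε L Λ : ℝ), 0 < κs → 0 < ε → 0 ≤ L → 0 < Λ → t₁ < T →
    Measurable k → (∀ τ, 0 ≤ k τ) → (∀ τ ∈ Set.Ico t₁ T, k τ ≤ κs) → ContinuousOn k (Set.Ico t₁ T) →
    (∀ s t : ℝ, t₁ ≤ s → s ≤ t → t < T → (∀ τ ∈ Set.Icc s t, κs - ε ≤ k τ) →
      Real.log ((T - s) / (T - t)) ≤ L) →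
    (∀ s t : ℝ, t₁ ≤ s → s ≤ t → t < T → (∀ τ ∈ Set.Icc s t, κs - ε ≤ k τ) →
      |k t - k s| ≤ Λ * Real.log ((T - s) / (T - t))) →
    ∃ θ₀ B : ℝ, 0 ≤ θ₀ ∧ θ₀ < 1 ∧ ∀ t ∈ Set.Ico t₁ T,
      ∫ τ in t₁..t, k τ ^ 2 / (T - τ) ≤ (θ₀ * κs) ^ 2 * Real.log ((T - t₁) / (T - t)) + B := by
  intro k T t₁ κs ε L Λ hκs hε hL hΛ ht₁T _hkm hk0 hkκ hcont hsoj hlip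
  have hTt₁ : 0 < T - t₁ := sub_pos.2 ht₁T
  -- the log-time parametrisation `φ σ = T − (T − t₁) e^{−σ}`
  obtain ⟨φ, hφ⟩ : ∃ φ : ℝ → ℝ, φ = fun σ => T - (T - t₁) * Real.exp (-σ) := ⟨_, rfl⟩
  have hTφ : ∀ σ, T - φ σ = (T - t₁) * Real.exp (-σ) := fun σ => by rw [hφ]; ring
  have hφT : ∀ σ, φ σ < T := fun σ => by
    have : 0 < (T - t₁) * Real.exp (-σ) := by positivity
    linarith [hTφ σ]
  have hφt₁ : ∀ σ, 0 ≤ σ → t₁ ≤ φ σ := fun σ hσ => by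
    have h1 : Real.exp (-σ) ≤ 1 := Real.exp_le_one_iff.2 (by linarith)
    have h2 : (T - t₁) * Real.exp (-σ) ≤ (T - t₁) * 1 := mul_le_mul_of_nonneg_left h1 hTt₁.le
    linarith [hTφ σ]
  have hφmono : ∀ a b, a ≤ b → φ a ≤ φ b := fun a b hab => by
    have h1 : Real.exp (-b) ≤ Real.exp (-a) := Real.exp_le_exp.2 (by linarith)
    have h2 := mul_le_mul_of_nonneg_left h1 hTt₁.le
    linarith [hTφ a, hTφ b]
  have hφcont : Continuous φ := by rw [hφ]; fun_prop
  have hφderiv : ∀ σ, HasDerivAt φ ((T - t₁) * Real.exp (-σ)) σ := fun σ => by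
    rw [hφ]
    exact (((hasDerivAt_neg σ).exp.const_mul (T - t₁)).const_sub T).congr_deriv (by ring)
  have hlogφ : ∀ a b, Real.log ((T - φ a) / (T - φ b)) = b - a := fun a b => by
    rw [hTφ a, hTφ b, mul_div_mul_left _ _ hTt₁.ne', ← Real.exp_sub, Real.log_exp]
    ring
  -- the log-time efficiency `g = k ∘ φ` and the shrunken zone width `ε' = min ε κs`
  obtain ⟨g, hg⟩ : ∃ g : ℝ → ℝ, g = fun σ => k (φ σ) := ⟨_, rfl⟩
  obtain ⟨ε', hε'⟩ : ∃ ε' : ℝ, ε' = min ε κs := ⟨_, rfl⟩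
  have hε'0 : 0 < ε' := by rw [hε']; exact lt_min hε hκs
  have hε'κ : ε' ≤ κs := by rw [hε']; exact min_le_right _ _
  have hε'ε : ε' ≤ ε := by rw [hε']; exact min_le_left _ _
  have hgcont : ContinuousOn g (Ici 0) := by
    rw [hg]
    exact hcont.comp hφcont.continuousOn fun σ hσ => ⟨hφt₁ σ hσ, hφT σ⟩
  have hg0' : ∀ σ : ℝ, 0 ≤ σ → 0 ≤ g σ := fun σ _ => by rw [hg]; exact hk0 _
  have hgκ' : ∀ σ : ℝ, 0 ≤ σ → g σ ≤ κs := fun σ hσ => by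
    rw [hg]; exact hkκ _ ⟨hφt₁ σ hσ, hφT σ⟩
  -- the zone in log-time maps into the zone in time
  have hzone : ∀ a b : ℝ, 0 ≤ a → a ≤ b → (∀ σ ∈ Icc a b, κs - ε' ≤ g σ) →
      ∀ τ ∈ Icc (φ a) (φ b), κs - ε ≤ k τ := by
    intro a b ha hab hz τ hτ
    have hτT : τ < T := lt_of_le_of_lt hτ.2 (hφT b)
    have hTτ : 0 < T - τ := sub_pos.2 hτT
    have hpos : 0 < (T - t₁) / (T - τ) := div_pos hTt₁ hTτ
    obtain ⟨σ, hσ⟩ : ∃ σ : ℝ, σ = Real.log ((T - t₁) / (T - τ)) := ⟨_, rfl⟩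
    have hφσ : φ σ = τ := by
      rw [hφ, hσ]
      simp only
      rw [Real.exp_neg, Real.exp_log hpos, inv_div]
      field_simp
      ring
    have hσab : σ ∈ Icc a b := by
      constructor
      · rw [hσ, Real.le_log_iff_exp_le hpos, le_div_iff₀ hTτ]
        have h1 : T - τ ≤ (T - t₁) * Real.exp (-a) := by linarith [hτ.1, hTφ a]
        have h2 := mul_le_mul_of_nonneg_left h1 (Real.exp_pos a).le
        calc Real.exp a * (T - τ) ≤ Real.exp a * ((T - t₁) * Real.exp (-a)) := h2
          _ = T - t₁ := by rw [Real.exp_neg]; field_simp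
      · rw [hσ, Real.log_le_iff_le_exp hpos, div_le_iff₀ hTτ]
        have h1 : (T - t₁) * Real.exp (-b) ≤ T - τ := by linarith [hτ.2, hTφ b]
        have h2 := mul_le_mul_of_nonneg_left h1 (Real.exp_pos b).le
        calc T - t₁ = Real.exp b * ((T - t₁) * Real.exp (-b)) := by rw [Real.exp_neg]; field_simp
          _ ≤ Real.exp b * (T - τ) := h2
    have h := hz σ hσab
    rw [hg] at h
    simp only at h
    rw [hφσ] at h
    linarith
  have hsoj' : ∀ a b : ℝ, 0 ≤ a → a ≤ b → (∀ σ ∈ Icc a b, κs - ε' ≤ g σ) → b - a ≤ L := by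
    intro a b ha hab hz
    have := hsoj (φ a) (φ b) (hφt₁ a ha) (hφmono a b hab) (hφT b) (hzone a b ha hab hz)
    rwa [hlogφ] at this
  have hlip' : ∀ a b : ℝ, 0 ≤ a → a ≤ b → (∀ σ ∈ Icc a b, κs - ε' ≤ g σ) →
      |g b - g a| ≤ Λ * (b - a) := by
    intro a b ha hab hz
    have := hlip (φ a) (φ b) (hφt₁ a ha) (hφmono a b hab) (hφT b) (hzone a b ha hab hz)
    rw [hlogφ] at this
    rw [hg]
    exact this
  obtain ⟨θ₀, B, hθ0, hθ1, hcore⟩ :=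
    mean_sq_le_of_sojourn hκs hε'0 hε'κ hL hΛ hgcont hg0' hgκ' hsoj' hlip'
  refine ⟨θ₀, B, hθ0, hθ1, fun t ht => ?_⟩
  -- change of variables `τ = φ σ` on `[0, S]`, `S = log((T−t₁)/(T−t))`
  have hTt : 0 < T - t := sub_pos.2 ht.2
  have hpos : 0 < (T - t₁) / (T - t) := div_pos hTt₁ hTt
  obtain ⟨S, hSdef⟩ : ∃ S : ℝ, S = Real.log ((T - t₁) / (T - t)) := ⟨_, rfl⟩
  have hS0 : 0 ≤ S := by
    rw [hSdef]
    exact Real.log_nonneg ((one_le_div hTt).2 (by linarith [ht.1]))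
  have hφ0 : φ 0 = t₁ := by rw [hφ]; simp
  have hφS : φ S = t := by
    rw [hφ, hSdef]
    simp only
    rw [Real.exp_neg, Real.exp_log hpos, inv_div]
    field_simp
    ring
  have hsub : ∫ τ in t₁..t, k τ ^ 2 / (T - τ) = ∫ σ in 0..S, g σ ^ 2 := by
    have h := intervalIntegral.integral_comp_mul_deriv_of_deriv_nonneg (a := 0) (b := S) (f := φ)
      (f' := fun σ => (T - t₁) * Real.exp (-σ)) (g := fun τ => k τ ^ 2 / (T - τ))
      hφcont.continuousOn (fun x _ => hφderiv x) (fun x _ => by positivity)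
    rw [hφ0, hφS] at h
    rw [← h]
    refine intervalIntegral.integral_congr fun σ _ => ?_
    have hne : (T - t₁) * Real.exp (-σ) ≠ 0 := by positivity
    simp only [Function.comp_apply]
    rw [hTφ σ, hg]
    field_simp
  rw [hsub, ← hSdef]
  exact hcore S hS0

end Summit.NavierStokesRegularity.NavierStokesRegularity.Theorems.NearExtremalTransiencePerFlow.ZoneTransversality

end
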